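import Mathlib
import Summits.MatrixMultiplication.MatrixMultiplication.Theses.LevelGradedCohnUmans
import Summits.MatrixMultiplication.MatrixMultiplication.Theorems.LevelTwoBeatsCubes.Negative.GradedNeumannCount

/-!
# `GradedDesignFamily` (crux `stmt-MatrixMultiplication-7610`, route `LevelGradedCohnUmans`):
# the abelian-index bound for graded designs (negative-side support)

Support file for the line `quadratic-extension-level-one-cell` (strategist census F2, "abelian-index
bound"); everything `sorry`-free.  The crux asks for a finite group `G`, a bi-invariant test space
`J ≤ ℂ^G` and a `J`-SEPARATED triple `X, Y, Z ⊆ G` — for every target `(x₀, z₀)` some `f ∈ J` reads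
`f(x⁻¹ y y'⁻¹ z) = [x = x₀ ∧ y = y' ∧ z = z₀]` on `X × Y × Y × Z` — beating the graded budget.
Proved here, for every finite group `G`:

* `sep_mono` — separation passes to sub-triples `X₁ ⊆ X, Y₁ ⊆ Y, Z₁ ⊆ Z`;
* `sep_image_mul_right` — for a right-translation-invariant `J`, separation passes to the right
  translates `(X, Y·a, Z·b)` (test function `g ↦ f(g b⁻¹)`);
* `exists_coset_piece_card_le` — pigeonhole over the right cosets of a subgroup `A`: every finite
  `Y ⊆ G` has a piece `Y₁ ⊆ Y` inside ONE right coset `A y₁` with `|Y| ≤ [G:A]·|Y₁|`;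
* `volume_le_finrank_of_comm_right` — **graded packing with commuting `Y`, `Z`**: if `J` is merely
  right-translation invariant, `(X, Y, Z)` is `J`-separated and every `y ∈ Y` commutes with every
  `z ∈ Z`, then `|X|·|Y|·|Z| ≤ dim J` (the translates `t ↦ f_{x₀z₀}(t y₀⁻¹)` restrict on the points
  `x⁻¹ y z` to the distinct point indicators; block-triangular evaluation count
  `LevelTwoBeatsCubes.Negative.card_add_card_le_finrank`).  This is the group-free form of the
  abelian packing bound `GradedPricing.Negative.volume_le_finrank_of_comm`;
* `volume_le_index_sq_mul_finrank` — **the abelian-index bound**: for every subgroup `A ≤ G` whose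
  elements pairwise commute, `|X|·|Y|·|Z| ≤ [G:A]²·dim J` (pigeonhole `Y`, `Z` into single right
  cosets of `A`, translate the pieces into `A`, apply the previous bound).  Hosts of graded designs
  must therefore be "non-abelian enough": a host with an abelian subgroup of bounded index carries
  only `O(dim J)` volume, which is void for the crux.
-/

noncomputable section

set_option linter.dupNamespace false

open scoped BigOperators

namespace Summit.MatrixMultiplication.MatrixMultiplication.Theorems.GradedDesignFamily.Negative

/-! ## Separation is inherited by sub-triples and right translates -/

/-- Separation of `(X, Y, Z)` by the functions of `J` passes to every sub-triple
`X₁ ⊆ X, Y₁ ⊆ Y, Z₁ ⊆ Z` (same test functions). [folklore] -/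
theorem sep_mono {G : Type} [Group G] (J : Submodule ℂ (G → ℂ)) {X Y Z X₁ Y₁ Z₁ : Finset G}
    (hX : X₁ ⊆ X) (hY : Y₁ ⊆ Y) (hZ : Z₁ ⊆ Z)
    (hsep : ∀ x₀ ∈ X, ∀ z₀ ∈ Z, ∃ f ∈ J, ∀ x ∈ X, ∀ y ∈ Y, ∀ y' ∈ Y, ∀ z ∈ Z,
      (x = x₀ ∧ y = y' ∧ z = z₀ → f (x⁻¹ * y * y'⁻¹ * z) = 1) ∧
      (¬ (x = x₀ ∧ y = y' ∧ z = z₀) → f (x⁻¹ * y * y'⁻¹ * z) = 0)) :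
    ∀ x₀ ∈ X₁, ∀ z₀ ∈ Z₁, ∃ f ∈ J, ∀ x ∈ X₁, ∀ y ∈ Y₁, ∀ y' ∈ Y₁, ∀ z ∈ Z₁,
      (x = x₀ ∧ y = y' ∧ z = z₀ → f (x⁻¹ * y * y'⁻¹ * z) = 1) ∧
      (¬ (x = x₀ ∧ y = y' ∧ z = z₀) → f (x⁻¹ * y * y'⁻¹ * z) = 0) := by
  intro x₀ hx₀ z₀ hz₀
  obtain ⟨f, hf, h⟩ := hsep x₀ (hX hx₀) z₀ (hZ hz₀)
  exact ⟨f, hf, fun x hx y hy y' hy' z hz => h x (hX hx) y (hY hy) y' (hY hy') z (hZ hz)⟩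

/-- For a right-translation-invariant `J`, separation of `(X, Y, Z)` passes to the right translates
`(X, Y·a, Z·b)`: the target `(x₀, z₀ b)` is read by `g ↦ f_{x₀ z₀}(g b⁻¹) ∈ J`, since
`x⁻¹ (y a) (y' a)⁻¹ (z b) b⁻¹ = x⁻¹ y y'⁻¹ z` and right multiplication is injective. [folklore] -/
theorem sep_image_mul_right {G : Type} [Group G] [DecidableEq G] (J : Submodule ℂ (G → ℂ))
    (hJ : ∀ f ∈ J, ∀ a : G, (fun g : G => f (g * a)) ∈ J) (X Y Z : Finset G) (a b : G)
    (hsep : ∀ x₀ ∈ X, ∀ z₀ ∈ Z, ∃ f ∈ J, ∀ x ∈ X, ∀ y ∈ Y, ∀ y' ∈ Y, ∀ z ∈ Z,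
      (x = x₀ ∧ y = y' ∧ z = z₀ → f (x⁻¹ * y * y'⁻¹ * z) = 1) ∧
      (¬ (x = x₀ ∧ y = y' ∧ z = z₀) → f (x⁻¹ * y * y'⁻¹ * z) = 0)) :
    ∀ x₀ ∈ X, ∀ z₀ ∈ Z.image (· * b), ∃ f ∈ J,
      ∀ x ∈ X, ∀ y ∈ Y.image (· * a), ∀ y' ∈ Y.image (· * a), ∀ z ∈ Z.image (· * b),
      (x = x₀ ∧ y = y' ∧ z = z₀ → f (x⁻¹ * y * y'⁻¹ * z) = 1) ∧
      (¬ (x = x₀ ∧ y = y' ∧ z = z₀) → f (x⁻¹ * y * y'⁻¹ * z) = 0) := by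
  intro x₀ hx₀ w₀ hw₀
  obtain ⟨z₀, hz₀, rfl⟩ := Finset.mem_image.mp hw₀
  obtain ⟨f, hf, hspec⟩ := hsep x₀ hx₀ z₀ hz₀
  refine ⟨fun g => f (g * b⁻¹), hJ f hf b⁻¹, ?_⟩
  intro x hx u hu u' hu' w hw
  obtain ⟨y, hy, rfl⟩ := Finset.mem_image.mp hu
  obtain ⟨y', hy', rfl⟩ := Finset.mem_image.mp hu'
  obtain ⟨z, hz, rfl⟩ := Finset.mem_image.mp hw
  have he : x⁻¹ * (y * a) * (y' * a)⁻¹ * (z * b) * b⁻¹ = x⁻¹ * y * y'⁻¹ * z := by group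
  have hiff : (x = x₀ ∧ y * a = y' * a ∧ z * b = z₀ * b) ↔ (x = x₀ ∧ y = y' ∧ z = z₀) := by
    rw [mul_left_inj, mul_left_inj]
  have h := hspec x hx y hy y' hy' z hz
  rw [← he, ← hiff] at h
  exact h

/-! ## Pigeonhole over right cosets -/

/-- Pigeonhole over the right cosets of a subgroup `A` of a finite group: every finite `Y ⊆ G`
contains a piece `Y₁ ⊆ Y` lying in a single right coset `A y₁` (i.e. `y y₁⁻¹ ∈ A` for `y ∈ Y₁`)
with `|Y| ≤ [G:A]·|Y₁|` (take the largest fibre of `y ↦ A y`). [folklore] -/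
theorem exists_coset_piece_card_le {G : Type} [Group G] [Fintype G] (A : Subgroup G)
    (Y : Finset G) :
    ∃ y₁ : G, ∃ Y₁ : Finset G, Y₁ ⊆ Y ∧ (∀ y ∈ Y₁, y * y₁⁻¹ ∈ A) ∧
      Y.card ≤ A.index * Y₁.card := by
  classical
  rcases Y.eq_empty_or_nonempty with rfl | hY
  · exact ⟨1, ∅, Finset.Subset.refl _, fun y hy => absurd hy (Finset.notMem_empty y), by simp⟩
  let q : G → G ⧸ A := fun y => ((y⁻¹ : G) : G ⧸ A)
  have hq : ∀ y y' : G, q y = q y' ↔ y * y'⁻¹ ∈ A := fun y y' => by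
    show ((y⁻¹ : G) : G ⧸ A) = ((y'⁻¹ : G) : G ⧸ A) ↔ _
    rw [QuotientGroup.eq, inv_inv]
  obtain ⟨y₁, -, hmax⟩ :=
    Y.exists_max_image (fun y => (Y.filter fun y' => q y' = q y).card) hY
  refine ⟨y₁, Y.filter fun y' => q y' = q y₁, Finset.filter_subset _ _, ?_, ?_⟩
  · intro y hy
    exact (hq y y₁).mp (Finset.mem_filter.mp hy).2
  · have h1 : Y.card ≤ (Y.filter fun y' => q y' = q y₁).card * (Y.image q).card :=
      Finset.card_le_mul_card_image Y _ fun c hc => by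
        obtain ⟨y, hy, rfl⟩ := Finset.mem_image.mp hc
        exact hmax y hy
    have h2 : (Y.image q).card ≤ A.index := by
      rw [Subgroup.index_eq_card, Nat.card_eq_fintype_card]
      exact Finset.card_le_univ _
    calc Y.card ≤ (Y.filter fun y' => q y' = q y₁).card * (Y.image q).card := h1
      _ ≤ (Y.filter fun y' => q y' = q y₁).card * A.index := Nat.mul_le_mul_left _ h2
      _ = A.index * (Y.filter fun y' => q y' = q y₁).card := mul_comm _ _

/-! ## Graded packing with commuting `Y`, `Z` -/

/-- Commuting elements have commuting inverses: `y z = z y ⟹ z y⁻¹ = y⁻¹ z`. [folklore] -/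
theorem mul_inv_eq_inv_mul_of_comm {G : Type} [Group G] {y z : G} (h : y * z = z * y) :
    z * y⁻¹ = y⁻¹ * z :=
  ((id h : Commute y z).inv_left).eq.symm

/-- **Graded packing with commuting `Y`, `Z`.**  In a finite group, if `X, Y, Z` are separated by
the functions of a right-translation-invariant subspace `J ≤ ℂ^G` — for every target `(x₀, z₀)`
some `f ∈ J` has `f(x⁻¹ y y'⁻¹ z) = [x = x₀ ∧ y = y' ∧ z = z₀]` on `X × Y × Y × Z` — and every
element of `Y` commutes with every element of `Z`, then `|X|·|Y|·|Z| ≤ dim J`: the translate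
`t ↦ f_{x₀z₀}(t y₀⁻¹)` lies in `J` and, as `z y₀⁻¹ = y₀⁻¹ z`, restricts on the points `x⁻¹ y z`
to the indicator of `(x₀, y₀, z₀)`, so evaluation `J → ℂ^{X × Y × Z}` is onto.  (The abelian case
is `GradedPricing.Negative.volume_le_finrank_of_comm`.) [folklore] -/
theorem volume_le_finrank_of_comm_right {G : Type} [Group G] [Fintype G]
    (J : Submodule ℂ (G → ℂ)) (hJ : ∀ f ∈ J, ∀ a : G, (fun g : G => f (g * a)) ∈ J)
    (X Y Z : Finset G)
    (hsep : ∀ x₀ ∈ X, ∀ z₀ ∈ Z, ∃ f ∈ J, ∀ x ∈ X, ∀ y ∈ Y, ∀ y' ∈ Y, ∀ z ∈ Z,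
      (x = x₀ ∧ y = y' ∧ z = z₀ → f (x⁻¹ * y * y'⁻¹ * z) = 1) ∧
      (¬ (x = x₀ ∧ y = y' ∧ z = z₀) → f (x⁻¹ * y * y'⁻¹ * z) = 0))
    (hcomm : ∀ y ∈ Y, ∀ z ∈ Z, y * z = z * y) :
    X.card * Y.card * Z.card ≤ Module.finrank ℂ J := by
  classical
  have h := LevelTwoBeatsCubes.Negative.card_add_card_le_finrank
    (A := ↥(X ×ˢ Y ×ˢ Z)) (S := Fin 0) J
    (fun a => a.1.1⁻¹ * a.1.2.1 * a.1.2.2) Fin.elim0 ?_ (fun s => Fin.elim0 s)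
  · simp only [Fintype.card_coe, Fintype.card_fin, add_zero] at h
    rw [Finset.card_product, Finset.card_product, ← mul_assoc] at h
    exact h
  · rintro ⟨⟨x₀, y₀, z₀⟩, h₀⟩
    simp only [Finset.mem_product] at h₀
    obtain ⟨f, hf, hspec⟩ := hsep x₀ h₀.1 z₀ h₀.2.2
    refine ⟨fun t => f (t * y₀⁻¹), hJ f hf _, ?_, ?_, fun s => Fin.elim0 s⟩
    · show f (x₀⁻¹ * y₀ * z₀ * y₀⁻¹) = 1
      rw [mul_assoc (x₀⁻¹ * y₀) z₀ y₀⁻¹, mul_inv_eq_inv_mul_of_comm (hcomm y₀ h₀.2.1 z₀ h₀.2.2),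
        ← mul_assoc]
      exact (hspec x₀ h₀.1 y₀ h₀.2.1 y₀ h₀.2.1 z₀ h₀.2.2).1 ⟨rfl, rfl, rfl⟩
    · rintro ⟨⟨x, y, z⟩, hxyz⟩ hne
      simp only [Finset.mem_product] at hxyz
      show f (x⁻¹ * y * z * y₀⁻¹) = 0
      rw [mul_assoc (x⁻¹ * y) z y₀⁻¹, mul_inv_eq_inv_mul_of_comm (hcomm y₀ h₀.2.1 z hxyz.2.2),
        ← mul_assoc]
      refine (hspec x hxyz.1 y hxyz.2.1 y₀ h₀.2.1 z hxyz.2.2).2 ?_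
      rintro ⟨rfl, rfl, rfl⟩
      exact hne rfl

/-! ## The abelian-index bound -/

/-- **Abelian-index bound for graded designs.**  In a finite group `G`, for every subgroup `A`
whose elements pairwise commute, every right-translation-invariant `J ≤ ℂ^G` and every
`J`-separated triple, `|X|·|Y|·|Z| ≤ [G:A]²·dim J`: by pigeonhole some right coset `A y₁`
(resp. `A z₁`) holds a piece `Y₁ ⊆ Y` (resp. `Z₁ ⊆ Z`) with `|Y| ≤ [G:A]|Y₁|`, `|Z| ≤ [G:A]|Z₁|`;
the translated sub-triple `(X, Y₁ y₁⁻¹, Z₁ z₁⁻¹)` is still `J`-separated, lives in `G × A × A`,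
and `volume_le_finrank_of_comm_right` gives `|X||Y₁||Z₁| ≤ dim J`.  So a host with an abelian
subgroup of index `h` carries at most `h²·dim J` volume. [folklore] -/
theorem volume_le_index_sq_mul_finrank {G : Type} [Group G] [Fintype G]
    (A : Subgroup G) (hA : ∀ a ∈ A, ∀ b ∈ A, a * b = b * a)
    (J : Submodule ℂ (G → ℂ)) (hJ : ∀ f ∈ J, ∀ a : G, (fun g : G => f (g * a)) ∈ J)
    (X Y Z : Finset G)
    (hsep : ∀ x₀ ∈ X, ∀ z₀ ∈ Z, ∃ f ∈ J, ∀ x ∈ X, ∀ y ∈ Y, ∀ y' ∈ Y, ∀ z ∈ Z,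
      (x = x₀ ∧ y = y' ∧ z = z₀ → f (x⁻¹ * y * y'⁻¹ * z) = 1) ∧
      (¬ (x = x₀ ∧ y = y' ∧ z = z₀) → f (x⁻¹ * y * y'⁻¹ * z) = 0)) :
    X.card * Y.card * Z.card ≤ A.index ^ 2 * Module.finrank ℂ J := by
  classical
  obtain ⟨y₁, Y₁, hY₁Y, hY₁A, hYcard⟩ := exists_coset_piece_card_le A Y
  obtain ⟨z₁, Z₁, hZ₁Z, hZ₁A, hZcard⟩ := exists_coset_piece_card_le A Z
  have hsep₁ := sep_image_mul_right J hJ X Y₁ Z₁ y₁⁻¹ z₁⁻¹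
    (sep_mono J (Finset.Subset.refl X) hY₁Y hZ₁Z hsep)
  have hcomm : ∀ u ∈ Y₁.image (· * y₁⁻¹), ∀ v ∈ Z₁.image (· * z₁⁻¹), u * v = v * u := by
    intro u hu v hv
    obtain ⟨y, hy, rfl⟩ := Finset.mem_image.mp hu
    obtain ⟨z, hz, rfl⟩ := Finset.mem_image.mp hv
    exact hA _ (hY₁A y hy) _ (hZ₁A z hz)
  have key := volume_le_finrank_of_comm_right J hJ X (Y₁.image (· * y₁⁻¹)) (Z₁.image (· * z₁⁻¹))
    hsep₁ hcomm
  rw [Finset.card_image_of_injective _ (mul_left_injective _),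
    Finset.card_image_of_injective _ (mul_left_injective _)] at key
  calc X.card * Y.card * Z.card ≤ X.card * (A.index * Y₁.card) * (A.index * Z₁.card) :=
        Nat.mul_le_mul (Nat.mul_le_mul_left _ hYcard) hZcard
    _ = A.index ^ 2 * (X.card * Y₁.card * Z₁.card) := by ring
    _ ≤ A.index ^ 2 * Module.finrank ℂ J := Nat.mul_le_mul_left _ key

/-- **One-sided abelian-index bound (single-coset middle set).**  If `J` is right-translation
invariant, `(X, Y, Z)` is `J`-separated, the elements of the subgroup `A` pairwise commute, and `Y`
lies in ONE right coset of `A` (`y y₁⁻¹ ∈ A` for all `y ∈ Y`), then `|X||Y||Z| ≤ [G:A]·dim J` — one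
index factor instead of two: partition `Z` along the right cosets of `A` (the volume is additive in
`Z`), translate each piece and `Y` into `A`, and apply `volume_le_finrank_of_comm_right` piecewise.
For the Frobenius cells `Z_p ⋊ μ_h` (`A = Z_p`, `[G:A] = h`, `dim J_Σ = |Σ| h`) this is the
strategist's fibre fact "a single-slope set never beats the exponent-3 threshold `h²|Σ|`", for every
finite group and every right-invariant `J` (lead c3). [folklore] -/
theorem volume_le_index_mul_finrank_of_coset {G : Type} [Group G] [Fintype G]
    (A : Subgroup G) (hA : ∀ a ∈ A, ∀ b ∈ A, a * b = b * a)
    (J : Submodule ℂ (G → ℂ)) (hJ : ∀ f ∈ J, ∀ a : G, (fun g : G => f (g * a)) ∈ J)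
    (X Y Z : Finset G)
    (hsep : ∀ x₀ ∈ X, ∀ z₀ ∈ Z, ∃ f ∈ J, ∀ x ∈ X, ∀ y ∈ Y, ∀ y' ∈ Y, ∀ z ∈ Z,
      (x = x₀ ∧ y = y' ∧ z = z₀ → f (x⁻¹ * y * y'⁻¹ * z) = 1) ∧
      (¬ (x = x₀ ∧ y = y' ∧ z = z₀) → f (x⁻¹ * y * y'⁻¹ * z) = 0))
    (y₁ : G) (hY : ∀ y ∈ Y, y * y₁⁻¹ ∈ A) :
    X.card * Y.card * Z.card ≤ A.index * Module.finrank ℂ J := by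
  classical
  -- the coset map (right cosets of `A` as fibres)
  let q : G → G ⧸ A := fun z => ((z⁻¹ : G) : G ⧸ A)
  have hq : ∀ z z' : G, q z = q z' ↔ z * z'⁻¹ ∈ A := fun z z' => by
    show ((z⁻¹ : G) : G ⧸ A) = ((z'⁻¹ : G) : G ⧸ A) ↔ _
    rw [QuotientGroup.eq, inv_inv]
  -- each fibre of `Z` contributes at most `dim J`
  have hfib : ∀ b : G ⧸ A, X.card * Y.card * (Z.filter fun z => q z = b).card ≤
      Module.finrank ℂ J := by
    intro b
    rcases (Z.filter fun z => q z = b).eq_empty_or_nonempty with h0 | ⟨z₁, hz₁⟩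
    · simp [h0]
    set Z₁ := Z.filter fun z => q z = b with hZ₁
    have hZ₁Z : Z₁ ⊆ Z := Finset.filter_subset _ _
    have hZ₁A : ∀ z ∈ Z₁, z * z₁⁻¹ ∈ A := fun z hz => by
      have h1 := (Finset.mem_filter.mp hz).2
      have h2 := (Finset.mem_filter.mp hz₁).2
      exact (hq z z₁).mp (h1.trans h2.symm)
    have hsep₁ := sep_image_mul_right J hJ X Y Z₁ y₁⁻¹ z₁⁻¹
      (sep_mono J (Finset.Subset.refl X) (Finset.Subset.refl Y) hZ₁Z hsep)
    have hcomm : ∀ u ∈ Y.image (· * y₁⁻¹), ∀ v ∈ Z₁.image (· * z₁⁻¹), u * v = v * u := by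
      intro u hu v hv
      obtain ⟨y, hy, rfl⟩ := Finset.mem_image.mp hu
      obtain ⟨z, hz, rfl⟩ := Finset.mem_image.mp hv
      exact hA _ (hY y hy) _ (hZ₁A z hz)
    have key := volume_le_finrank_of_comm_right J hJ X (Y.image (· * y₁⁻¹)) (Z₁.image (· * z₁⁻¹))
      hsep₁ hcomm
    rwa [Finset.card_image_of_injective _ (mul_left_injective _),
      Finset.card_image_of_injective _ (mul_left_injective _)] at key
  -- sum over the fibres
  have hZsum : Z.card = ∑ b : G ⧸ A, (Z.filter fun z => q z = b).card :=
    Finset.card_eq_sum_card_fiberwise fun z _ => Finset.mem_univ (q z)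
  have hindex : Fintype.card (G ⧸ A) = A.index := by
    rw [Subgroup.index, Nat.card_eq_fintype_card]
  calc X.card * Y.card * Z.card = ∑ b : G ⧸ A, X.card * Y.card * (Z.filter fun z => q z = b).card := by
        rw [hZsum, Finset.mul_sum]
    _ ≤ ∑ _b : G ⧸ A, Module.finrank ℂ J := Finset.sum_le_sum fun b _ => hfib b
    _ = A.index * Module.finrank ℂ J := by
        rw [Finset.sum_const, Finset.card_univ, smul_eq_mul, hindex]

end Summit.MatrixMultiplication.MatrixMultiplication.Theorems.GradedDesignFamily.Negative

end
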